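import Summits.NavierStokesRegularity.NavierStokesRegularity.Theses.CoriolisHead
import Summits.NavierStokesRegularity.NavierStokesRegularity.Theorems.CoriolisHeadCounterRotatingLiouville
import Summits.NavierStokesRegularity.NavierStokesRegularity.Theorems.CoriolisHeadSolitonToProfile
import HarnessLib

/-!
# Route CoriolisHead · crux `NoCoRotatingCore` (stmt-NavierStokesRegularity-22676) — what is left, exactly

Support file (`--supports stmt-NavierStokesRegularity-22676`; theorems only, no definitions, no named facts).
With `CounterRotatingLiouville` (stmt-22677, `counterRotatingLiouville_proof`) and `SolitonToProfile`
(stmt-22678, `coriolisHead_solitonToProfile_proof`) PROVED, the route's one open attacked item is the crux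
`NoCoRotatingCore`.  This file records, as kernel-checked statements, where that leaves the line:

* `noCoRotatingCore_iff_rotatedProfileLiouville` — `NoCoRotatingCore` is now EQUIVALENT to the route's `X`
  (bounded rotated-profile Liouville: every smooth bounded solution of the rotated Leray profile system
  `−νΔU + aU + a DU[y] + (BU − DU[By]) + DU[U] + ∇P = 0`, `div U = 0`, `ν, a > 0`, `B` skew, is constant —
  Pineau–Vicol's Conjecture 1.1 in the stronger bounded, all-rotation-rates form).  The sign split of the birth
  certificate is exhausted: the open crux carries all of `X`.
* `spiralScalingLiouville_of_noCoRotatingCore` — hence the crux ALONE implies the host crux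
  `ExtremalTypeIConstant.SpiralScalingLiouville` (stmt-NavierStokesRegularity-8216); for the summit the route
  still needs, besides this crux, its two declared residuals `ExtremalSpiralSymmetry` (stmt-8215) and `NoTypeII`
  (stmt-0056) — `CoriolisHead.closes` with the three proved items supplied by their tree proofs.
* `rotatingHeadSource_eq_zero_of_nonneg` — CO-ROTATION SPHERE RIGIDITY for BOUNDED profiles: the source
  `½ν Σ (∂ₗUᵢ − ∂ᵢUₗ)² + 2ν Σₗ (B ∂ₗU)ₗ = ν(|curl U|² + 2 tr(B∘DU)) = ν(|curl U − β|² − |β|²)` of the rotating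
  head pressure `Π_B = ½|U|² + P + a⟨y,U⟩ − ⟨By,U⟩` cannot be `≥ 0` everywhere unless it vanishes identically
  (the landed stubs of stmt-22677: identity, polynomial growth, skew Lemma 5.1).  Contrapositive
  (`exists_rotatingHeadSource_neg`): unless the vorticity of a bounded rotated profile lies ON the co-rotation
  sphere `|curl U − β| = |β|` everywhere, it enters the OPEN ball `|curl U − β| < |β|` somewhere — a necessary
  condition on the co-rotating core sharper than `β·curl U > 0` somewhere (which is the contrapositive of
  stmt-22677).  The decaying, `B = αJ` version of this rigidity is the tree's
  `CorkscrewProfile.Birth.rotatedLerayProfile_vorticity_on_corotationSphere`.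

HONEST FRAMING. Nothing here proves `NoCoRotatingCore`, `X`, or Navier–Stokes regularity; `X` is open
(Pineau–Vicol 2026, Conj. 1.1, open already for decaying profiles at rotation rates `α ≈ 1`), and the route's
residuals `ExtremalSpiralSymmetry` (stmt-8215) and `NoTypeII` (stmt-0056) are open problems.

References: T.-P. Tsai, ARMA 143 (1998) 29–51, Thm 1, Lemma 5.1 [Tsai1998]; B. Pineau, V. Vicol,
arXiv:2607.09619, Conj. 1.1 and p. 4 [PineauVicol2026].
-/

noncomputable section

-- the summit and its single sub-problem share the name (CONVENTIONS §1), as in every Theorems file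
set_option linter.dupNamespace false

open scoped BigOperators RealInnerProductSpace
open Literature.Analysis.FluidPDE
open Summit.NavierStokesRegularity.NavierStokesRegularity.Theses

namespace Summit.NavierStokesRegularity.NavierStokesRegularity.Theorems.CoriolisHead

/-! ### Co-rotation sphere rigidity for bounded rotated profiles -/

/-- **Co-rotation sphere rigidity (bounded profiles, any skew frame rate).** For a smooth bounded rotated
Leray profile, if the source `½ν Σ (∂ₗUᵢ − ∂ᵢUₗ)² + 2ν Σₗ (B ∂ₗU)ₗ` (`= ν(|curl U − β|² − |β|²)`) of the
rotating head pressure `Π_B` is `≥ 0` everywhere — the vorticity never enters the open co-rotation ball —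
then it vanishes identically: the vorticity lies on the co-rotation sphere everywhere.  (`Π_B` is then a
polynomially bounded subsolution of the skew drift–Laplace operator, hence constant by the skew Lemma 5.1,
and the identity is read backwards.) [cite: Tsai1998, Lemma 5.1 and (1.7) (the case B = 0)] -/
theorem rotatingHeadSource_eq_zero_of_nonneg (ν a : ℝ) (hν : 0 < ν) (ha : 0 < a)
    (B : EuclideanSpace ℝ (Fin 3) →L[ℝ] EuclideanSpace ℝ (Fin 3))
    (U : EuclideanSpace ℝ (Fin 3) → EuclideanSpace ℝ (Fin 3)) (P : EuclideanSpace ℝ (Fin 3) → ℝ)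
    (hU : ContDiff ℝ (⊤ : ℕ∞) U) (hP : ContDiff ℝ 2 P) (hB : ∀ x, inner ℝ (B x) x = 0)
    (hdiv : VectorCalculus.IsDivFree U)
    (heq : ∀ y, -(ν • Laplacian.laplacian U y) + a • U y + a • fderiv ℝ U y y
      + (B (U y) - fderiv ℝ U y (B y)) + convect U U y + gradient P y = 0)
    (hbdd : ∃ M : ℝ, ∀ y, ‖U y‖ ≤ M)
    (hsrc : ∀ y, 0 ≤ 2⁻¹ * ν * (∑ l, ∑ i, (pderiv l (fun z => U z i) y - pderiv i (fun z => U z l) y) ^ 2)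
      + 2 * ν * ∑ l, (B (fderiv ℝ U y (EuclideanSpace.single l 1))) l) :
    ∀ y, 2⁻¹ * ν * (∑ l, ∑ i, (pderiv l (fun z => U z i) y - pderiv i (fun z => U z l) y) ^ 2)
      + 2 * ν * ∑ l, (B (fderiv ℝ U y (EuclideanSpace.single l 1))) l = 0 := by
  -- the rotating head is a subsolution: identity + sign hypothesis on the source
  have hsub : ∀ y, 0 ≤ driftOp ν a (fun z => U z - B z)
      (fun z => headPressure a U P z - ⟪B z, U z⟫) y := fun y => by
    rw [stub_rotatingHeadIdentity ν a B U P hU hP hB hdiv heq y]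
    exact hsrc y
  -- polynomial growth of the rotating head, then the skew Lemma 5.1: the head is constant
  have hgrowth := stub_rssHeadGrowth ν a hν ha B U P hU hP hB hdiv heq hbdd
  have hconst := stub_skewLiouville51 ν a hν ha B U P hU hP hB hdiv heq hbdd hsub hgrowth
  -- a constant is killed by the drift operator; read the identity backwards
  have hΘ : (fun z => headPressure a U P z - ⟪B z, U z⟫) =
      fun _ => headPressure a U P 0 - ⟪B 0, U 0⟫ := funext fun x => hconst x 0
  intro y
  have hdrift : driftOp ν a (fun z => U z - B z)
      (fun z => headPressure a U P z - ⟪B z, U z⟫) y = 0 := by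
    rw [hΘ]; exact driftOp_const _ _ _
  rw [← stub_rotatingHeadIdentity ν a B U P hU hP hB hdiv heq y]
  exact hdrift

/-- **The co-rotating core enters the open co-rotation ball.** Contrapositive of
`rotatingHeadSource_eq_zero_of_nonneg`: if the source of the rotating head pressure of a smooth bounded
rotated Leray profile is nonzero at some point (the vorticity is off the co-rotation sphere there), then it
is NEGATIVE somewhere — `|curl U|² < 2β·curl U` at some point, i.e. the vorticity enters the open ball
`|curl U − β| < |β|`; in particular the profile co-rotates there. [cite: Tsai1998, Lemma 5.1 (the case B = 0)] -/
theorem exists_rotatingHeadSource_neg (ν a : ℝ) (hν : 0 < ν) (ha : 0 < a)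
    (B : EuclideanSpace ℝ (Fin 3) →L[ℝ] EuclideanSpace ℝ (Fin 3))
    (U : EuclideanSpace ℝ (Fin 3) → EuclideanSpace ℝ (Fin 3)) (P : EuclideanSpace ℝ (Fin 3) → ℝ)
    (hU : ContDiff ℝ (⊤ : ℕ∞) U) (hP : ContDiff ℝ 2 P) (hB : ∀ x, inner ℝ (B x) x = 0)
    (hdiv : VectorCalculus.IsDivFree U)
    (heq : ∀ y, -(ν • Laplacian.laplacian U y) + a • U y + a • fderiv ℝ U y y
      + (B (U y) - fderiv ℝ U y (B y)) + convect U U y + gradient P y = 0)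
    (hbdd : ∃ M : ℝ, ∀ y, ‖U y‖ ≤ M)
    (hoff : ∃ y, 2⁻¹ * ν * (∑ l, ∑ i, (pderiv l (fun z => U z i) y - pderiv i (fun z => U z l) y) ^ 2)
      + 2 * ν * ∑ l, (B (fderiv ℝ U y (EuclideanSpace.single l 1))) l ≠ 0) :
    ∃ y, 2⁻¹ * ν * (∑ l, ∑ i, (pderiv l (fun z => U z i) y - pderiv i (fun z => U z l) y) ^ 2)
      + 2 * ν * ∑ l, (B (fderiv ℝ U y (EuclideanSpace.single l 1))) l < 0 := by
  by_contra h
  push Not at h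
  obtain ⟨y, hy⟩ := hoff
  exact hy (rotatingHeadSource_eq_zero_of_nonneg ν a hν ha B U P hU hP hB hdiv heq hbdd h y)

/-! ### The open crux is the whole of `X` -/

/-- **`NoCoRotatingCore ↔ X`.** With `CounterRotatingLiouville` (stmt-22677) proved, the open crux
`NoCoRotatingCore` of route CoriolisHead is equivalent to bounded rotated-profile Liouville `X` (stated
verbatim as the hypothesis of `SolitonToProfile`): `→` feeds the pointwise sign into
`counterRotatingLiouville_proof`; `←` because a constant profile has `DU = 0`, so every defect term
`(B ∂ₗU)ₗ` vanishes. [cite: PineauVicol2026, Conjecture 1.1 (arXiv:2607.09619 p. 3)] -/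
theorem noCoRotatingCore_iff_rotatedProfileLiouville :
    CoriolisHead.NoCoRotatingCore ↔
      (∀ (ν a : ℝ), 0 < ν → 0 < a → ∀ (B : EuclideanSpace ℝ (Fin 3) →L[ℝ] EuclideanSpace ℝ (Fin 3))
        (U : EuclideanSpace ℝ (Fin 3) → EuclideanSpace ℝ (Fin 3)) (P : EuclideanSpace ℝ (Fin 3) → ℝ),
        ContDiff ℝ (⊤ : ℕ∞) U → ContDiff ℝ 2 P → (∀ x, inner ℝ (B x) x = 0) →
        Literature.Analysis.FluidPDE.VectorCalculus.IsDivFree U →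
        (∀ y, -(ν • Laplacian.laplacian U y) + a • U y + a • fderiv ℝ U y y
          + (B (U y) - fderiv ℝ U y (B y)) + Literature.Analysis.FluidPDE.convect U U y
          + gradient P y = 0) →
        (∃ M : ℝ, ∀ y, ‖U y‖ ≤ M) → ∃ b : EuclideanSpace ℝ (Fin 3), ∀ y, U y = b) := by
  constructor
  · intro hCore ν a hν ha B U P hU hP hB hdiv heq hbdd
    exact counterRotatingLiouville_proof ν a hν ha B U P hU hP hB hdiv heq hbdd
      (hCore ν a hν ha B U P hU hP hB hdiv heq hbdd)
  · intro hX ν a hν ha B U P hU hP hB hdiv heq hbdd y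
    obtain ⟨b, hb⟩ := hX ν a hν ha B U P hU hP hB hdiv heq hbdd
    have hUc : U = fun _ => b := funext hb
    have hD : fderiv ℝ U y = 0 := by
      rw [hUc]
      exact fderiv_const_apply b
    simp [hD]

/-- **The open crux alone implies the host crux.** `NoCoRotatingCore → ExtremalTypeIConstant.SpiralScalingLiouville`
(stmt-NavierStokesRegularity-8216): compose `noCoRotatingCore_iff_rotatedProfileLiouville` with the proved
support `SolitonToProfile` (stmt-22678). [cite: PineauVicol2026, Conjecture 1.1 (arXiv:2607.09619 p. 3)] -/
theorem spiralScalingLiouville_of_noCoRotatingCore (hCore : CoriolisHead.NoCoRotatingCore) :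
    ExtremalTypeIConstant.SpiralScalingLiouville :=
  coriolisHead_solitonToProfile_proof (noCoRotatingCore_iff_rotatedProfileLiouville.1 hCore)

end Summit.NavierStokesRegularity.NavierStokesRegularity.Theorems.CoriolisHead

end
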